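import Summits.ResolutionOfSingularities.ResolutionOfSingularities.Theorems.TameCutKernels
import Literature.AlgebraicGeometry.Resolution.BlowupsProperProofs
import Literature.AlgebraicGeometry.Resolution.BlowupReducedDimension
import Literature.AlgebraicGeometry.Resolution.Hironaka2005BasicFactsRegularEquiv
import HarnessLib

/-!
# TameCutStage — decomp-res node «LatencyCut» (lens-4 g22) refining the MaxContactCut asides 28054 / 32260; tree
file 1/5 of the node

Content VERBATIM from the decomp-res lens-4 g22 file `HOME/decomp-res-lens-4/g22/LatencyCut.lean` (sha256 6bd4fa7be8c896a2,
940 l, written directly against the tree on top of the landed g21 node «TameCut» = `Theorems/TameCutClasses`,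
`TameCutKernels`,
`MaxContactCutTameCut`).  HOME = run/shared/lean/pub/decomp-res.  Critic: CRITIC-LEDGER row 137 CLEARED, landing
order 2026-08-30T19:54:01Z.

Route-independent, cone-free: §48 THE CLASS PERSISTS ALONG THE TOWER (hypothesis-free, standard axioms) — every
stage of a forced tower is
again a base (`toRoot`, composite structure map separated / locally of finite type / quasi-compact; regular of
dimension ≤ 4) carrying a datum of
the SAME weight with the SAME maximal order (`tower_isDatum`, `tower_idealOrder_pt_eq`, …).

[WRITER NOTE (decomp-res writer g7): namespace `…Theorems.HugValuationCut` as the whole lens-4 chain; split by the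
critic's order into
`TameCutStage` (§48), `LatencyCutKernels` (§49 + §53), `LatencyCutClasses` (§50) + `LatencyCutCells` (§51 + the
§52 all-weights CLASSES; the
critic's single `LatencyCutClasses` exceeds the 400-line file limit, hence two files), all four route-independent
(OUTSIDE the Theses cone,
importing only the cone-free `TameCutKernels` instead of the lens's `MaxContactCutTameCut`), and
`MaxContactCutLatencyCut` (inside the cone:
the §52 BY-NAME theorems + the two port-conditional theorems `noTowerPerfect_latent_of_ports` (§50) /
`latentPerfectOffLocus_of_ports` (§51),
whose binder `MaxContactCut.MarkedThreefoldResolution` is a route decl).  `section StageKernel` re-opened in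
`LatencyCutKernels`; the global
`set_option linter.dupNamespace false` dropped; nothing else changed.]

## The lens's node description (VERBATIM)

# LatencyCut — decomp-res lens-4 («minimal-counterexample / extremal reduction»), generation 22

HOST TARGETS BY NAME: the booked aside 28054 `MaxContactCut.TCNoWildOffLocusTowers` (= g21's located residual
`HugValuationCut.NoWildOffLocusTowers`, (O, p ∣ n), landed 2026-08-30 as `Theorems/TameCutClasses`, `TameCutKernels`,
`MaxContactCutTameCut`), the host 32260 `MaxContactCut.NoSingularSurfaceHuggingTowers`, the ROOT 30253
`MaxContactCut.NoForcedTowers`; up-links 32203 `NoSurfaceHuggingTowers`, 31570 `NoHuggingTowers`; the orthogonal leaves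
31571 `NoContactHuggingTowers` (consumed BY NAME) and 31572 `NoWildHuggingTowers` (cut, hypothesis-free).  Lineage: g14
HugValuationCut … g19 RiderCut, g21 TameCut (tree).  This file extends the tree's g21 state (`noTower_iff_g21`,
`offLocus_iff_g21`, `noSingularSurfaceHuggingTowers_iff_g21'`): after g21 the open mass of the lens-4 column is the WILD bed
(O, p ∣ n) `WildOffLocusTowersTerminate` = aside 28054, the tame–inseparable bed (imperfect `k`), the same two beds of
(L,¬P), the pure-principal cell and the g19 imperfect residual.  WINDOW (critic row 134, item (i)): decide a TYPED
sub-cell of the WILD bed by the law «a non-`p`-power initial form at SOME stage ⇒ contact from there», with a kernel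
 theorem at stage `m`, the EXACT re-location of `NoWildOffLocusTowers`, census inhabitants, and the residual «purely
inseparable initial forms at every stage» TYPED.

## THE EXTREMAL OBJECT OF g22: THE CONTACT LATENCY OF A MINIMAL COUNTEREXAMPLE

A minimal infinite forced tower `T` (weight `n`, points `x_j ∈ T.St j`) either acquires an ABSOLUTE CONTACT ELEMENT at
some stage — `LatentContact n T := ∃ j, IsAbsContactAt (T.D j).ideal n (T.pt j)`, i.e. `Diff^{≤ n−1}_ℤ(I_{j,x_j}) ⊄ 𝔪²_{x_j}`
(lens-6's absolute predicate, NO field, NO residue, NO separability binder) — or it is PERMANENTLY ABSOLUTELY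
CONTACT-FREE, `ContactFreeTower n T := ∀ j, ¬ IsAbsContactAt …` (Hironaka's purely inseparable situation at EVERY
infinitely near point).  The minimal `j` is the CONTACT LATENCY of the counterexample; g21 decided latency `0` on the
tame–separable bed; g22 decides EVERY FINITE LATENCY on EVERY bed:

  `NoTower n P ⟺ NoTowerLatent n P [∃ contact stage] ∧ NoTowerContactFree n P [no contact stage ever]`
(`noTower_iff_g22`),
  and the same EXACT bisection of g21's wild and tame–inseparable columns (`noTowerWild_split`, `noTowerTameInsep_split`).

## THE KERNEL THEOREMS (§48–§49 · hypothesis-free · standard axioms · NO PORT)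

* §48 THE CLASS PERSISTS ALONG THE TOWER (answer to row 134 h4 — HOW separability / finite type at stage `m` are
  obtained: for the COMPOSITE structure map `toRoot T m ≫ g : T.St m ⟶ Spec k`).  `tower_isBase`: every stage is a base
  (separated, locally of finite type, quasi-compact — blow-ups are proper, tree `IsBlowup.isProper`, and these classes
  compose; regular, g21; `dim ≤ 4`, tree `IsBlowup.topologicalKrullDim_le_of_isLocallyNoetherian`); `tower_isNoetherian`;
  `tower_isDatum`: `IsDatum n (T.D i)` at EVERY stage — the maximal order `n` does not increase under the permissible point
  blow-ups (tree `Hironaka2005.idealOrder_controlledTransform_le_of_isRegular`, Cossart–Piltant 2008 Prop. 4.2 (a)), so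
  `ord_{x_i} I_i = n` exactly (`tower_idealOrder_pt_eq`).
* §49 THE LATENCY ENGINE `hugsGerm_of_isAbsContactAt_stage` / `contactHugging_of_isAbsContactAt_stage`: an absolute
  contact element at ANY stage `m` spreads (tree `centreSpread` on the Noetherian stage) to an ideal sheaf `H ∋ x_m` with
  `ord_{x_m} H = 1` whose strict transforms pass through every later point (Giraud persistence re-rooted at `m`:
  `tower_absInv_strictIter_from`, from the tree's `tower_absInv_succ`): `HugsGerm T m H`, hence `ContactHugging T` with
  witness stage `m` («contact FROM THERE»).  THE CONTACT STAGES FORM AN UP-SET (`isAbsContactAt_succ`,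
  `isAbsContactAt_of_le`).  THE TAME CONTACT THEOREM AT EVERY STAGE (`isAbsContactAt_of_tame_sepStage`,
  `contactHugging_of_tame_sepStage`): `p ∤ n` and `κ(x_m)/k` separable for SOME `m` ⇒ contact at `x_m` (g21's
  `isAbsContactAt_of_tame_sep` on the stage, which IS a base with a datum of maximal order `n` by §48).  Conversely a tame
  contact-free tower is PERMANENTLY INSEPARABLE (`not_sepResidueAt_stage_of_contactFree`) and a contact-free tower is wild
  or has an inseparable root (`dvd_or_not_sepResidueAt_of_contactFree`): THE RESIDUAL OF THE CUT LIES INSIDE g21's.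

## CONSEQUENCES (§50–§52)

* THE LATENT COLUMN OF EVERY CLASS IS A CONTACT COLUMN: `noTowerLatent_of_contact (hn : 1 ≤ n) :
  ContactHuggingTowersTerminate n → NoTowerLatent n P` (no port, every field); a class disjoint from contact has EMPTY
  latent column (`noTowerLatent_of_not_contact`; the latent half of 31572 is EMPTY: `latentWildHugging_empty`,
  `wildHugging_iff_g22 : WildHuggingTowersTerminate n ⟺ ContactFreeWildHuggingTowersTerminate n`, hypothesis-free);
  over a PERFECT field the latent column is EMPTY modulo the tree's g12 ports + X1 28616 (`noTowerPerfect_latent_of_ports`,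
  via `MaxContactCutContactShadow.contactPerfect_of_ports`; X1 scope = the critic's row-76 booking verbatim: «X1 28616
  KNOWN-MOD-PORT(perfect) BY NAME c := n!» — the booked item's scope, not Cutkosky2009 Thm. 5.1's).
* THE DECIDED SUB-CELL OF THE WILD BED: `WildLatentOffLocusTowersTerminate n` ⊆ 31571 BY KERNEL
  (`wildLatentOffLocus_of_contact`); EXACT RE-LOCATION OF g21's LOCATED RESIDUAL GIVEN 31571:
  `wildOffLocus_iff_g22 : WildOffLocusTowersTerminate n ⟺ WildContactFreeOffLocusTowersTerminate n`, all weights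
  `noWildOffLocusTowers_iff_g22`, and ON THE BOOKED ITEM 28054: `tcNoWildOffLocusTowers_iff_g22 (h71) :
  MaxContactCut.TCNoWildOffLocusTowers ⟺ NoWildContactFreeOffLocusTowers`.  Same for the tame–inseparable bed
  (`tameInsepOffLocus_iff_g22`) and for (L,¬P); hypothesis-free bed calculus of the residual
  (`contactFreeOffLocus_iff_beds : (O, cf) ⟺ (O, wild, cf) ∧ (O, tame–insep, cf)` — its tame–separable bed is EMPTY
  outright, `noTowerTameSep_contactFree`).
* EXACT RE-LOCATIONS BY NAME: `offLocus_iff_g22`, `nonPrincipal_iff_g22`, `singularSurface_iff_g22`, `ftt_step_of_g22`;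
  all weights `noOffLocusShadowTowers_iff_g22`, `noNonPrincipalInLocusTowers_iff_g22`,
  `noSingularSurfaceHuggingTowers_iff_g22` (GIVEN 31571), `noSingularSurfaceHuggingTowers_iff_g22_beds` (on g21's axis),
  `noSingularSurfaceHuggingTowers_iff_g22'` (g19's hypothesis list EXACTLY; the latent cells explicit, certified `⊆ 31571`
  by `noLatentOffLocusTowers_of_item` / `noLatentNonPrincipalInLocusTowers_of_item`), `noForcedTowers_iff_g22` (31571 as
  a booked conjunct), up-links `noSurfaceHuggingTowers_of_g22`, `noHuggingTowers_of_g22`.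

## THE g22 EXACT STATEMENT (tree g19 ports; `⟦…⟧` = booked BY NAME elsewhere)

  28054 ⟺ NoWildContactFreeOffLocusTowers                    GIVEN ⟦31571⟧            (`tcNoWildOffLocusTowers_iff_g22`)
  32260 ⟺ ⟦31571-cells: NoLatentOffLocusTowers ∧ NoLatentNonPrincipalInLocusTowers⟧ ∧ NoContactFreeOffLocusTowers
        ∧ NoContactFreeNonPrincipalInLocusTowers ∧ NoPurePrincipalTowers ∧ NoIncommensurableWildDriftingImperfectTowers

(`noSingularSurfaceHuggingTowers_iff_g22'`)
        ⟺ (O,wild,cf) ∧ (O,tame–insep,cf) ∧ (L,¬P,wild,cf) ∧ (L,¬P,tame–insep,cf) ∧ (L,P,pure) ∧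
(imperfect residual)
          GIVEN ⟦31571⟧
(`noSingularSurfaceHuggingTowers_iff_g22_beds`)
  30253 ⟺ 31571 ∧ (O, cf) ∧ (L,¬P, cf) ∧ (L,P,pure) ∧ (imperfect residual)             (`noForcedTowers_iff_g22`)
  31572 ⟺ NoContactFreeWildHuggingTowers
(`noWildHuggingTowers_iff_g22`, NO hypothesis)

## TAGS (pieces of the host after g22)
| piece | tag | leaf status |
|---|---|---|
| `WildLatentOffLocusTowersTerminate n` (O, p ∣ n, finite latency) — THE DECIDED SUB-CELL of aside 28054 | ⊆
31571 BY KERNEL (`wildLatentOffLocus_of_contact`); perfect column EMPTY-MOD-PORT(KNOWN)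
(`latentPerfectOffLocus_of_ports`) | booked on 31571 |
| `TameInsepLatentOffLocusTowersTerminate n`, `LatentNonPrincipalInLocusTowersTerminate n` | ⊆ 31571 BY KERNEL |
booked on 31571 |
| `WildContactFreeOffLocusTowersTerminate n` (O, p ∣ n, permanently contact-free) — THE LOCATED RESIDUAL of
28054 | WEAKER · UNDECIDED · LOCATED · TYPED (`ContactFreeTower`) | IDEA-NEEDED (Frobenius-type initial forms at
EVERY infinitely near point: the Moh / kangaroo habitat proper) · INSTRUMENTABLE (census: 5 of 433 wild chains) |
| `TameInsepContactFreeOffLocusTowersTerminate n` (O, p ∤ n, PERMANENTLY inseparable residue fields) | WEAKER ·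
UNDECIDED · LOCATED (imperfect k; `not_sepResidueAt_stage_of_contactFree`) | ATTACKABLE for F-finite k (absolute Hasse) |
| (L,¬P) beds likewise; `PurePrincipalTowersTerminate n` DECIDED-MOD-PORT INHERITED (g13); g19 imperfect residual
LOCATED | — | — |
| ports used | NONE NEW. Inherited COSTUME: ShadowPort, MarkingPort, DescentPort, FactorContactPort, CouplingPort,
RiderPort (g14–g19) in the BY-NAME wiring only; g12's ContactShadow/TowerObstructsAll + X1 only in the
`…_of_ports` corollaries | — |

WHY STRICTLY WEAKER / NOT COSTUME: `ContactFreeTower n T` is a pointwise-decidable sub-predicate of every tower class;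
the residual cells are WEAKER than g21's by letter (`wildContactFreeOffLocus_of_wildOffLocus`, `contactFreeOffLocus_of_g21`)
and BOTH halves of the latency split of the WILD bed are INHABITED by census footprints (HOME/census/it/T-wild-in.json,
replay of the 433 wild off-locus hug-forced chains over `𝔽_p`, proxy «`in_n(f_j)` has a monomial with an exponent
`≢ 0 mod p`» ⟺ «absolute contact of order `≤ n−1` at the `𝔽_p`-point `x_j`» by the Hasse/Lucas
dictionary of §53):
LATENT 428 chains — latency histogram `j* = 0: 90 · 1: 27 · 2: 73 · 3: 115 · 4: 72 · 5: 50 · 6: 1` (e.g.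
`2:A3line:y2+x4u:FOFF1:53`, p = 2, n = 4, root form `y u³ + y² u²`: contact at the root; `2:A3line:y2+x4u:FOFF1:50`, root
form `y² u²`, first contact at stage 3 with `y² u² + x u³`) — THE INHABITANTS OF THE DECIDED DIFFERENCE
`WildOffLocus ∖ WildContactFree`; CONTACT-FREE-SO-FAR 5 chains (`2:R3L:y^2+x^5+x^4u^3:ROFF1:5`, p = 2, n = 4, forms
`x² y² → … → y² u²`; `3:R11L:y^3+x^2y^2+x^4y^2:ROFF0:20` and
`3:R0L:y^3+2x^5u^3+2x^2u^5+x^4+x^2u^6:ROFF0:{10,16,20}`, p = n = 3,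
form `y³` at every replayed stage) — the inhabitants of the typed residual.  The must-fail probe `g22/bc/Probe.lean`
records that no cell, port or iff closes by the standard batteries (25 batteries) and that each kernel hypothesis is
load-bearing.

WHY NOVEL (relative to the route and the tree): g21 decided the tame–separable bed AT THE ROOT; the tree's lens-6
theorems give Giraud persistence for core branches.  New here: (i) the STAGE kernel — the base/datum classes persist
along lens-4's `ForcedTower` for the composite structure map (properness of blow-ups + non-increase of the maximal
order under permissible blow-ups, kernelised), (ii) the latency engine at an ARBITRARY stage and the up-set structure of
contact stages, (iii) the ABSOLUTE, binder-free typed predicate `LatentContact` / `ContactFreeTower` cutting EVERY bed of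
g21's axis with an EXACT port-free calculus, (iv) the tame contact theorem at every stage and the typed residual
«permanently inseparable» on the tame bed, (v) the exact re-location of the booked aside 28054.

Sources: [cite: Giraud1975] · [cite: EncinasVillamayor2000, Thm. 4.9] · [cite: BravoGarciaEscamillaVillamayor2012, Lemma 4.6]
· [cite: EGAIV4, Thm. 16.11.2] · [cite: CossartPiltant2008, Prop. 4.2] · [cite:
BierstoneGrigorievMilmanWlodarczyk2011, Lemma 3.4]
· [cite: GortzWedhorn2020, Prop. 13.96] · [cite: Liu2002, Thm. 8.1.19] · [cite: Matsumura1987, Thm. 15.5, Thm. 30.5]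
· [cite: CossartJannsenSaito2020] · [cite: CossartPiltant2019] · [cite: Hironaka1964] · [cite: Moh1987] ·
[cite: Cutkosky2009, Thm. 5.1].

(Sources: Giraud1975; EncinasVillamayor2000 Thm. 4.9; BravoGarciaEscamillaVillamayor2012 Lemma 4.6; EGAIV4 Thm.
16.11.2; CossartPiltant2008 Prop. 4.2; BierstoneGrigorievMilmanWlodarczyk2011 Lemma 3.4; GortzWedhorn2020 Prop.
13.96; Liu2002 Thm. 8.1.19; Matsumura1987 Thm. 15.5, Thm. 30.5; CossartJannsenSaito2020; CossartPiltant2019;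
Hironaka1964; Moh1987; Cutkosky2009 Thm. 5.1.)
-/

noncomputable section

open CategoryTheory AlgebraicGeometry IsLocalRing
open Literature.AlgebraicGeometry.Resolution
open Summit.ResolutionOfSingularities.ResolutionOfSingularities.Theorems
open WeakOrderReduction ForcedTowerClasses DivergentTowerClasses MonomialTowerClasses
open HugDimensionClasses HugDimensionKernels SurfaceShadowClasses SurfaceShadowKernels
open ContactShadowClasses (NoTowerImperfect ContactShadow TowerObstructsAll ContactPerfect)
open ContactShadowKernels (noTowerImperfect_of_noTower noTowerImperfect_mono noTower_iff_columns)
open NearPointCut (SingularClass singularSurface_iff_noTower)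
open AbsoluteContactClasses (IsAbsContactAt SepResidueAt AbsInv absInv_point hsPortSepResidue sepResidueAt_of_perfectField not_perfectField_of_not_sepResidueAt diffIdeal_restrict_le)

namespace Summit.ResolutionOfSingularities.ResolutionOfSingularities.Theorems.HugValuationCut

/-! ## §48 (g22 · NEW · KERNEL, hypothesis-free, standard axioms) THE CLASS PERSISTS ALONG THE TOWER — every stage of a
forced tower is again a base (composite structure map `T.St j ⟶ T.St 0 ⟶ Spec k`: separated, locally of finite type,
quasi-compact; regular of dimension ≤ 4) carrying a datum of the SAME weight with the SAME maximal order `n`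
(answer to critic row 134 h4: separability / finite type at stage `m` are stated for the composite `toRoot T m ≫ g`). -/

section StageKernel

variable {k : Type} [Field k]

/-- The composite blow-down `T.St j ⟶ T.St 0` of the first `j` point blow-ups of a forced tower. DEFINITION (support). -/
noncomputable def toRoot (T : ForcedTower) : (j : ℕ) → (T.St j ⟶ T.St 0)
  | 0 => 𝟙 (T.St 0)
  | j + 1 => T.π j ≫ toRoot T j

/-- unfolding. [folklore] -/
theorem toRoot_zero (T : ForcedTower) : toRoot T 0 = 𝟙 (T.St 0) := rfl

/-- unfolding. [folklore] -/
theorem toRoot_succ (T : ForcedTower) (j : ℕ) : toRoot T (j + 1) = T.π j ≫ toRoot T j := rfl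

/-- A scheme of the base class is Noetherian (locally of finite type over a field and quasi-compact). [folklore] -/
theorem isNoetherian_of_isBase {Y : Scheme.{0}} (g : Y ⟶ Spec (.of k)) (hB : IsBase Y g) : IsNoetherian Y := by
  haveI : LocallyOfFiniteType g := hB.locallyOfFiniteType
  haveI := LocallyOfFiniteType.isLocallyNoetherian g
  haveI : QuasiCompact g := hB.quasiCompact
  haveI : CompactSpace ↥(Spec (.of k)) := inferInstance
  haveI : CompactSpace ↥Y := QuasiCompact.compactSpace_of_compactSpace g
  exact {}

/-- **KERNEL (PROVED): EVERY STAGE OF A FORCED TOWER WITH A BASE ROOT IS A BASE** for the composite structure map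
`toRoot T j ≫ g` — blow-ups of locally Noetherian schemes are proper (tree `IsBlowup.isProper`: separated, universally
closed hence quasi-compact, locally of finite type), these classes are stable under composition, the stages are regular
(g21 `tower_isLocallyNoetherian_isRegular`) and blowing up does not raise the dimension (tree
`IsBlowup.topologicalKrullDim_le_of_isLocallyNoetherian`). (Sources: GortzWedhorn2020, Prop. 13.96 (1);
Matsumura1987, Thm. 15.5; Liu2002, Thm. 8.1.19.) -/
theorem tower_isBase (T : ForcedTower) (g : T.St 0 ⟶ Spec (.of k)) (hB : IsBase (T.St 0) g) :
    ∀ j, IsBase (T.St j) (toRoot T j ≫ g) := by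
  intro j
  induction j with
  | zero => rw [toRoot_zero, Category.id_comp]; exact hB
  | succ j ih =>
    haveI : IsLocallyNoetherian (T.St j) := (tower_isLocallyNoetherian_isRegular T g hB j).1
    haveI : IsProper (T.π j) := (T.isBlowup j).isProper
    haveI : IsSeparated (toRoot T j ≫ g) := ih.isSeparated
    haveI : LocallyOfFiniteType (toRoot T j ≫ g) := ih.locallyOfFiniteType
    haveI : QuasiCompact (toRoot T j ≫ g) := ih.quasiCompact
    refine ⟨?_, ?_, ?_, (tower_isLocallyNoetherian_isRegular T g hB (j + 1)).2, ?_⟩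
    · rw [toRoot_succ, Category.assoc]; infer_instance
    · rw [toRoot_succ, Category.assoc]; infer_instance
    · rw [toRoot_succ, Category.assoc]; infer_instance
    · have h4 : topologicalKrullDim (T.St j) ≤ ((4 : ℕ) : WithBot ℕ∞) := by exact_mod_cast ih.dim_le
      have := (T.isBlowup j).topologicalKrullDim_le_of_isLocallyNoetherian h4
      exact_mod_cast this

/-- Every stage of a forced tower with a base root is a Noetherian scheme. [folklore] -/
theorem tower_isNoetherian (T : ForcedTower) (g : T.St 0 ⟶ Spec (.of k)) (hB : IsBase (T.St 0) g) (j : ℕ) :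
    IsNoetherian (T.St j) :=
  isNoetherian_of_isBase (toRoot T j ≫ g) (tower_isBase T g hB j)

/-- **The marked order is EXACTLY the weight at every point of the tower** (`x_i ∈ supp (I_i, n)` and `ord ≤
n`). [folklore] -/
theorem idealOrder_pt_eq_of_isDatum (T : ForcedTower) {n : ℕ} (i : ℕ) (hDi : IsDatum n (T.D i)) :
    idealOrder (T.D i).ideal (T.pt i) = ((n : ℕ) : ℕ∞) := by
  have hge : ((T.D i).mult : ℕ∞) ≤ idealOrder (T.D i).ideal (T.pt i) := (T.isolated i).1
  rw [hDi.1] at hge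
  exact le_antisymm (hDi.2 (T.pt i)) hge

/-- **KERNEL (PROVED): THE DATUM CLASS PERSISTS ALONG THE TOWER** — `IsDatum n (T.D i)` at EVERY stage: the weight is
kept by the transform and the maximal order `n` does not increase under the permissible point blow-ups (tree
`Hironaka2005.idealOrder_controlledTransform_le_of_isRegular` = Cossart–Piltant 2008 Prop. 4.2 (a), applied at the
regular centre `{x_i}` where `ord_{x_i} I_i = n`). (Sources: CossartPiltant2008, proof of Prop. 4.2 (a);
BierstoneGrigorievMilmanWlodarczyk2011, Lemma 3.4.) -/
theorem tower_isDatum (T : ForcedTower) (g : T.St 0 ⟶ Spec (.of k)) (hB : IsBase (T.St 0) g) {n : ℕ}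
    (hD : IsDatum n (T.D 0)) : ∀ i, IsDatum n (T.D i) := by
  intro i
  induction i with
  | zero => exact hD
  | succ i ih =>
    obtain ⟨hNi, hRi⟩ := tower_isLocallyNoetherian_isRegular T g hB i
    obtain ⟨hNi1, -⟩ := tower_isLocallyNoetherian_isRegular T g hB (i + 1)
    haveI := hNi
    haveI := hNi1
    refine ⟨tower_mult_eq T hD (i + 1), fun y => ?_⟩
    have hDi1 : (T.D (i + 1)).ideal = controlledTransform (T.π i) (T.centre i) (T.D i).ideal n := by
      rw [T.transform_eq i, MarkedIdeal.transform_ideal, tower_mult_eq T hD i]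
    rw [hDi1]
    refine Hironaka2005.idealOrder_controlledTransform_le_of_isRegular hRi (T.centre_regular i) (T.isBlowup i) ?_ ih.2 y
    intro y' hy'
    have hy'' : y' ∈ ({T.pt i} : Set (T.St i)) := by rw [← T.centre_support i]; exact hy'
    rw [Set.mem_singleton_iff] at hy''
    rw [hy'']
    exact idealOrder_pt_eq_of_isDatum T i ih

/-- The marked order at every point of a forced tower with a datum root is exactly the weight. [folklore] -/
theorem tower_idealOrder_pt_eq (T : ForcedTower) (g : T.St 0 ⟶ Spec (.of k)) (hB : IsBase (T.St 0) g) {n : ℕ}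
    (hD : IsDatum n (T.D 0)) (i : ℕ) : idealOrder (T.D i).ideal (T.pt i) = ((n : ℕ) : ℕ∞) :=
  idealOrder_pt_eq_of_isDatum T i (tower_isDatum T g hB hD i)

end StageKernel

end Summit.ResolutionOfSingularities.ResolutionOfSingularities.Theorems.HugValuationCut
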